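import Literature.NumberTheory.Sieve.LinearEquationsInPrimesGowersU2
import Literature.NumberTheory.Sieve.LinearEquationsInPrimesNormalFormProofs
import HarnessLib

/-!
# Green–Tao 2010 at level `s = 1`, unconditionally: Thms. 5.2, 5.1 and 4.5 for `1`-normal forms

Topic `Literature/NumberTheory/Sieve`. Immediate consequences of the proved level-`1` Gowers
uniformity estimate `Literature.NumberTheory.Sieve.GreenTao2010_gowersUniformityAt_one`
(`‖Λ'_{b,W} − 1‖_{U²[N]} = o(1)`, `LinearEquationsInPrimesGowersU2.lean`) through the level-by-level
reductions of B. Green, T. Tao, *Linear equations in primes*, Ann. of Math. 171 (2010), all proved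
in the tree:

* `GreenTao2010_wTrickedProductAt_one` — Thm. 5.2 at `s = 1`
  (`∑_{n ∈ K ∩ ℤ^d} ∏ᵢ (Λ'_{bᵢ,W}(ψᵢ(n)) − 1) = o(N^d)` for nondegenerate systems in `1`-normal
  form), by §7 (`GreenTao2010_wTrickedProduct_of_gowersUniformity_holds`: Prop. 6.4, App. D, and
  the generalised von Neumann theorem Prop. 7.1, App. C);
* `GreenTao2010_wTrickedAt_one` — Thm. 5.1 at `s = 1` (`GreenTao2010_wTricked_of_wTrickedProduct`);
* `GreenTao2010_mainNormalFormAt_one` — **Thm. 4.5 at `s = 1`**: the generalised Hardy–Littlewood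
  asymptotic `∑_{n ∈ K ∩ ℤ^d} ∏ᵢ Λ(ψᵢ(n)) = β_∞ ∏_p β_p + o(N^d)` for every nondegenerate system of
  affine-linear forms in `1`-normal form of bounded size (e.g. the system
  `(n₂ + 2n₃, −n₁ + n₃, −2n₁ − n₂)` parametrising three-term progressions), by §5
  (`GreenTao2010_mainNormalForm_of_wTricked_holds`);
* `GreenTaoZiegler2012_finiteComplexity_of_two_le` — what remains of the Main Theorem for all
  systems of finite complexity: the levels `s ≥ 2` of Thm. 7.2 (i.e. `GI(s)`, Green–Tao–Ziegler
  2012, and `MN(s)`, Green–Tao 2012, through §§10–12), via the proved transference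
  `GreenTao2010_transference_holds`.

No new definitions, no named facts.

## References

* [GreenTao2010] B. Green, T. Tao, *Linear equations in primes*, Ann. of Math. 171 (2010),
  1753–1850: Thms. 4.5, 5.1, 5.2, 7.2; §§4, 5, 7 (arXiv:math/0606088).
-/

namespace Literature.NumberTheory.Sieve

/-- **Green–Tao 2010, Thm. 5.2 at `s = 1` (unconditional).**
[cite: GreenTao2010, Thm. 5.2 (case `s = 1`) and §7] -/
theorem GreenTao2010_wTrickedProductAt_one : GreenTao2010_wTrickedProductAt 1 :=
  GreenTao2010_wTrickedProduct_of_gowersUniformity_holds 1 le_rfl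
    GreenTao2010_gowersUniformityAt_one

/-- **Green–Tao 2010, Thm. 5.1 at `s = 1` (unconditional).**
[cite: GreenTao2010, Thm. 5.1 (case `s = 1`) and §5 (after Thm. 5.2)] -/
theorem GreenTao2010_wTrickedAt_one : GreenTao2010_wTrickedAt 1 :=
  GreenTao2010_wTricked_of_wTrickedProduct 1 GreenTao2010_wTrickedProductAt_one

/-- **Green–Tao 2010, Thm. 4.5 at `s = 1` (unconditional):** the generalised Hardy–Littlewood
asymptotic for nondegenerate systems of affine-linear forms in `1`-normal form.
[cite: GreenTao2010, Thm. 4.5 (case `s = 1`) and §5 (Proof of the Main Theorem assuming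
Theorem 5.1)] -/
theorem GreenTao2010_mainNormalFormAt_one : GreenTao2010_mainNormalFormAt 1 :=
  GreenTao2010_mainNormalForm_of_wTricked_holds 1 le_rfl GreenTao2010_wTrickedAt_one

/-- **The Main Theorem of Green–Tao 2010 for all systems of finite complexity, from the levels
`s ≥ 2` of Thm. 7.2 alone** (the level `s = 1` and the whole transference §§4–7 being proved).
[cite: GreenTao2010, Main Theorem (Thm. 1.2) and Thm. 7.2] -/
theorem GreenTaoZiegler2012_finiteComplexity_of_two_le
    (h : ∀ s : ℕ, 2 ≤ s → GreenTao2010_gowersUniformityAt s) :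
    GreenTaoZiegler2012_finiteComplexity :=
  GreenTao2010_transference_holds (GreenTao2010_gowersUniformity_of_two_le h)

end Literature.NumberTheory.Sieve
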